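import Mathlib
import HarnessLib
import Summits.ABC.ABC.Theses.CongruentialReceptacle
import Summits.ABC.ABC.Theorems.CongruentialReceptacleAssembly
import Summits.ABC.ABC.Theorems.CongruentialReceptacleQuarterWindowGivesCrux

/-!
# Disproof of `CompactBalanceTransfer` (crux stmt-ABC-1725, route CongruentialReceptacle) — findings

Crux: `CompactBalanceTransfer := H → ABC` with
`H := ∀ κ > 0, ∀ ε > 0, ∃ C, ∀ abc-triples, κc ≤ a → κc ≤ b → c < C · rad(abc)^(1+ε)`
(abc on the compactly balanced cell, for every balance `κ`).

FINDINGS (cdisprove cycle 1, refuter-cdisprove-stmt-ABC-1725-0):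

* §1 IRREFUTABILITY. `ABC → crux` (`crux_of_abc`) and `¬crux ↔ H ∧ ¬ABC` (`not_crux_iff`): every disproof of
  the crux is a disproof of ABC itself. No counterexample search, degenerate case or barrier reduction can
  refute it; the disprover's work on the crux proper is therefore STRUCTURAL (load-bearing analysis) and the
  attack goes to the picked line `Sketch` (§4).
* §2 LOAD-BEARING ANALYSIS. The crux has a single hypothesis `H`. Dropping it leaves the summit `ABC`
  (`CompactBalanceTransferWithoutH`, definitionally `ABC`) — so no `_false_without_H` theorem can exist short of
  `¬ABC`. Weakening `H` to ONE balance: the quantifier `∀ κ` in `H` is spurious — the crux is EQUIVALENT to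
  `QuarterBalancedABC → ABC` (`crux_iff_quarter`), abc on the single cell `min(a,b) ≥ c/4`, by the squaring
  descent already landed in the tree (`quarterWindowGivesCrux_proof`, `balancedABC_of_balancedFreySzpiro`).
  Strengthening `H` above balance `1/2` is vacuous (`no_balanced_triple_above_half`,
  `balancedABC_instance_of_half_lt`): the cell `κ > 1/2` is empty, so `H` only has content for `κ ≤ 1/2`,
  and by `crux_iff_quarter` only the instance `κ = 1/4` matters.
* §3 WHY IT RESISTS (for provers). `crux ∧ H ↔ ABC`-shape: `crux_iff_abc_of_H`. A proof of the crux that does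
  not use `H` is a proof of ABC (this is exactly what the picked line `Sketch` does: its single stub is
  ≥ ABC, see §4). A proof that USES `H` must move an arbitrary abc-triple into the cell `min(a,b) ≥ c/4` with
  polynomial loss in `c` and `rad`; cusp-preserving polynomial identities of bounded degree only improve the
  balance `k = min/c` to `≈ 2k` per squaring (`(a(a+2b), b², c²)`), so `≈ log(1/k)` steps are needed and the
  exponent `(1+ε₀)/(1−ε₀)` compounds unboundedly (card Lemma NA; informal, not formalised here).
* §4 LINE `Sketch` (one stub `CuspWeightedReceptacle`, restated verbatim below as `CuspWeightedReceptacle`).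
  (a) `abc_of_cuspWeighted…` is proved in `Lines/Sketch.lean`: the stub is ≥ ABC and `H` is unused.
  (b) RESIDUE-FREE strengthening: REFUTED and LANDED by the line lead before this seat started
      (`Theorems/CompactBalanceTransfer/Negative/CuspWeightedResidueFree.lean`, p96963,
      `not_cuspWeightedReceptacle_residueFree`; three triples `(1,2^k−1,2^k)`, `(2,2^k−1,2^k+1)`, `(1,2^k,2^k+1)`).
      The disprover's independent Lean proof (folder `NegResidueFree.lean`, rc 0, sorry-free) is NOT landed (duplicate);
      its sum-decomposition lemmas are kept as infrastructure for a residue-dependent certificate.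
  (c) RESIDUE-DEPENDENT stub — the attack of this cycle, by SIGNED FAMILIES OF POLYNOMIAL abc-IDENTITIES in `y = 2^k`
      ("slope certificates"; model in the disprover's NOTES.md §slope-LP; code polysearch3.py / lpsearch.py; kit jobs
      j017059 (deg ≤ 3: 40 930 triples, 646 Belyi, 112 094 classes) and j017052 (deg ≤ 4: 62 062 triples, 1 210 Belyi,
      177 502 classes), reports attached to the item as evidence):
      • MODEL. For a polynomial triple `(a,b,c)(y)`, `y = 2^k`, the table entry at a large prime `p ∣ φ(2^k)` (`φ` an
        irreducible factor of the member at position `pos` with multiplicity `m`) is determined by the CLASS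
        `(φ, pos, m, outer mod φ, cofactor mod φ)`; the prime 2 gives classes `(pos, v₂ = m·k + s)`; bounded primes are
        free (cost `O_A(1)`). A signed combination `Σ λ_T S_T` in which every class of a negatively weighted triple is
        covered is `≥ (Σ λ_T·rate T)·k log 2 − O_A(1)` and `≤ (c₃/c₁)·Σ|λ_T|`, where
        `rate T = deg c − deg rad_odd(abc) ≤ 0` (Mason–Stothers; `= 0` iff `a/c` is a Belyi map with `y ∣ abc` —
        "tight"); so `Σ λ_T rate T > 0` with coverage refutes the stub for small `ε`.  Dually the stub survives the
        whole pool iff nonnegative EXCESS slopes can be put on classes so that every triple of the pool balances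
        ("designer LP"); tight triples pin all their classes at the window, hence an immediate certificate is any
        non-Belyi polynomial triple all of whose classes are classes of Belyi triples.
      • SHARING IS POSSIBLE (corrects the lead's no-go in `Lines/Sketch.md` item 3, which assumed the small members are
        `< X`): two triples share a block `X` WITH residues as soon as their other members agree mod `X`, e.g.
        `(2^k−1, 1, 2^k)` and `(2^k−1, 2^k, 2^{k+1}−1)` share the a-block `2^k − 1` (`shared_mersenne_block`); polynomial
        families are the systematic form of this, and Belyi families (`(27(y−1), (2y−3)²(y+3), 4y³)`,
        `((y−1)(2y+1)², 3y+1, 4y³)`, `(1, y³(3y−4), (y−1)²(3y²+2y+1))`, …) supply hundreds of zero-cost covers.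
      • RESULT: NO CERTIFICATE in either universe — LP optimum exactly 0, propagation pins 1 583 / 3 288 classes without
        contradiction, and the designer LP returns an explicit consistent slope table (integral: excess 1 on one
        class per slack-1 triple; 32 493 / 49 632 classes carry excess).  Anatomy: every non-Belyi triple of the pool
        owns at least one class that no Belyi triple has — for the 96 + 122 slack-1 triples with a SINGLE non-Belyi
        class that class is a simple c-factor (`m = 1`, window `−ε`), e.g. `(y−1, y, 2y−1)` with `(2y−1 | c, 1 | a ≡
        −1/2, cof ≡ 1)`; the Belyi classes at `φ = y−1` with `m = 1` have invariants `(outer, cof) ∈ {(1,1), (1,2),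
        (1,3), (1,4), (1,9), (1,27), (4,9), (4,27), (±8,27), (27,81)}` — ramification makes cofactor values
        "powerful", and the class `(2, 1)` needed to cover `C = (y−1, y+1, 2y)` or `T₂ = (2, y−1, y+1)` never occurs.
      • DEEP BELYI SEARCH (j017605: Wronskian/log-derivative bucketing over 6 716 shapes × 685 rational double-root
        candidates, degree ≤ 5): 4 466 tight triples, 12 125 Belyi classes (172 at `φ = y−1`; simple a/b-classes there have
        `(outer, cof) ∈ {(1,1),(1,2),(1,4),(1,8),(1,9),(1,27),(3,8),(3,16),(4,9),(4,27),(±8,27),(−1,−8),(16,64),(27,64),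
        (27,81),(27,256),(216,625),(256,3125),(−1024,3125)}` — still no `(2,1)`); re-test of the 62 062-triple pool
        against the enlarged catalogue: 126 non-Belyi triples with exactly one uncovered class, NONE fully covered; LP
        on the union (66 528 triples, 186 804 classes): optimum 0.
      • UPPER-WINDOW (penalised) VERSION (j017584, j017614): allowing uncovered classes at the price of the upper window,
        a family refutes every table with `c₁′ ≤ A·c₁` iff `G(λ) − A·ν(λ) > 0` (`G = Σ λ_T rate T`,
        `ν = Σ_e (m_e+1)·deg φ_e·(−cov_e)⁺`).  The CRITICAL RATIO `A* = max G/ν` of the pool is EXACTLY 1/2 (deg ≤ 4 pool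
        and the union pool alike; extremal configuration `(y−9, y, 2y−9) − ½(y−9, 9, y) − ½(1, y, y+1)`, one uncovered
        simple c-class).  Admissible tables have `c₁′ ≥ c₁` (`A ≥ 1`), so even the penalised attack is void: at slope
        level there is a consistent "half-window" table `lb ≤ u ≤ lb + hi/2` on all 66 528 identities.
      • WHY IT RESISTS (for the provers and the sibling crux stmt-ABC-14354): at slope level the residue-dependent
        table has a PRIVATE class in every non-Belyi identity on which to dump that identity's Mason slack, and the
        upper window leaves a factor-2 margin (`A* = 1/2 < 1 ≤ A`); single-parameter polynomial families — the only
        uniform source of block sharing at all primes simultaneously (CRT controls residues only at primes `≪ log c`,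
        which carry `log log c` of the `log c` weight) — therefore refute NO admissible table up to degree 4/5.
        CONJECTURES (disprover): (i) no non-Belyi polynomial triple over `ℤ[y]` is shadowed class-by-class by Belyi
        triples; (ii) `A* = 1/2` for every finite pool (a half-window slope table always exists).  What would reopen the
        attack: a counterexample to (i) in any degree; a two-parameter `(2^k, 3^j)` / Lucas-sequence family with a closed
        class structure; or an Elliott–Wirsing rigidity theorem for residue-twisted additive functions (the lead's item 3).
        Status of the stub: OPEN, ≥ ABC, residue-free form refuted (lead), residue form resists slope certificates.

Everything in this file is `sorry`-free unless marked NEAR-MISS.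
-/

set_option linter.dupNamespace false
set_option linter.unusedVariables false

namespace Summit.ABC.ABC.Cruxes.CompactBalanceTransfer.Disproof

open Literature.NumberTheory.DiophantineGeometry
open Summit.ABC.ABC.Theses.CongruentialReceptacle

/-! ## §0 The hypothesis of the crux, named -/

/-- `H`: abc with exponent `1+ε` on every compactly balanced cell `min(a,b) ≥ κ c`. The crux is `H → ABC`. -/
def BalancedABC : Prop :=
  ∀ κ : ℝ, 0 < κ → ∀ ε : ℝ, 0 < ε → ∃ C : ℝ, ∀ a b c : ℕ, IsABCTriple a b c →
    κ * (c : ℝ) ≤ (a : ℝ) → κ * (c : ℝ) ≤ (b : ℝ) → (c : ℝ) < C * ((rad a b c : ℕ) : ℝ) ^ (1 + ε)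

/-- abc with exponent `1+ε` on the single cell `min(a,b) ≥ c/4`. -/
def QuarterBalancedABC : Prop :=
  ∀ ε : ℝ, 0 < ε → ∃ C : ℝ, ∀ a b c : ℕ, IsABCTriple a b c →
    (1 / 4 : ℝ) * (c : ℝ) ≤ (a : ℝ) → (1 / 4 : ℝ) * (c : ℝ) ≤ (b : ℝ) →
      (c : ℝ) < C * ((rad a b c : ℕ) : ℝ) ^ (1 + ε)

theorem crux_iff : CompactBalanceTransfer ↔ (BalancedABC → _root_.ABC) := Iff.rfl

/-! ## §1 Irrefutability: any refutation of the crux refutes ABC -/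

/-- ABC implies the crux (discard the hypothesis). -/
theorem crux_of_abc (h : _root_.ABC) : CompactBalanceTransfer := fun _ => h

/-- ABC implies the hypothesis `H` (the cell is a subset of all triples). -/
theorem balancedABC_of_abc (h : _root_.ABC) : BalancedABC := by
  intro κ _ ε hε
  obtain ⟨C, _, hC⟩ := (ABC_iff.mp h) ε hε
  exact ⟨C, fun a b c habc _ _ => hC a b c habc⟩

/-- A refutation of the crux is exactly `H ∧ ¬ABC`; in particular it contains a refutation of ABC. -/
theorem not_crux_iff : ¬ CompactBalanceTransfer ↔ (BalancedABC ∧ ¬ _root_.ABC) := Classical.not_imp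

theorem not_abc_of_not_crux (h : ¬ CompactBalanceTransfer) : ¬ _root_.ABC :=
  fun hA => h (crux_of_abc hA)

/-- Under `H` the crux is literally ABC. -/
theorem crux_iff_abc_of_H (hH : BalancedABC) : CompactBalanceTransfer ↔ _root_.ABC :=
  ⟨fun hT => hT hH, fun hA => crux_of_abc hA⟩

/-! ## §2 Load-bearing analysis of the single hypothesis `H` -/

/-- The crux with `H` dropped is the summit itself; `_false_without_H` would be `¬ABC`. -/
def CompactBalanceTransferWithoutH : Prop := _root_.ABC

theorem withoutH_iff_summit : CompactBalanceTransferWithoutH ↔ _root_.ABC := Iff.rfl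

/-- The balanced cell is EMPTY above balance `1/2`: `a + b = c` with `κc ≤ a`, `κc ≤ b` forces `2κ ≤ 1`. -/
theorem no_balanced_triple_above_half {κ : ℝ} (hκ : 1 / 2 < κ) {a b c : ℕ} (h : IsABCTriple a b c)
    (ha : κ * (c : ℝ) ≤ (a : ℝ)) (hb : κ * (c : ℝ) ≤ (b : ℝ)) : False := by
  obtain ⟨ha0, hb0, habc, _⟩ := h
  have hc : (c : ℝ) = (a : ℝ) + (b : ℝ) := by rw [← habc]; push_cast; ring
  have hcpos : (0 : ℝ) < (c : ℝ) := by rw [hc]; exact_mod_cast Nat.add_pos_left ha0 b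
  nlinarith

/-- Hence every instance of `H` with `κ > 1/2` holds vacuously (any constant works). -/
theorem balancedABC_instance_of_half_lt {κ : ℝ} (hκ : 1 / 2 < κ) :
    ∀ ε : ℝ, 0 < ε → ∃ C : ℝ, ∀ a b c : ℕ, IsABCTriple a b c →
      κ * (c : ℝ) ≤ (a : ℝ) → κ * (c : ℝ) ≤ (b : ℝ) → (c : ℝ) < C * ((rad a b c : ℕ) : ℝ) ^ (1 + ε) :=
  fun _ _ => ⟨0, fun _ _ _ h ha hb => (no_balanced_triple_above_half hκ h ha hb).elim⟩

/-- `H` at balance `1/4` (abc currency) gives the Szpiro-currency quarter window consumed by the tree's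
descent theorem: on any abc triple `(abc)² ≤ c⁶`, and `c < C₀ rad^(1+ε/6)` gives `c⁶ ≤ |C₀|⁶ rad^(6+ε)`. -/
theorem szpiroQuarter_of_quarterBalancedABC (hQ : QuarterBalancedABC) :
    ∀ ε : ℝ, 0 < ε → ∃ C : ℝ, ∀ a b c : ℕ, IsABCTriple a b c →
      (1 / 4 : ℝ) * (c : ℝ) ≤ (a : ℝ) → (1 / 4 : ℝ) * (c : ℝ) ≤ (b : ℝ) →
        ((a * b * c : ℕ) : ℝ) ^ 2 ≤ C * ((rad a b c : ℕ) : ℝ) ^ (6 + ε) := by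
  intro ε hε
  obtain ⟨C₀, hC₀⟩ := hQ (ε / 6) (by positivity)
  refine ⟨|C₀| ^ 6, fun a b c habc ha hb => ?_⟩
  have hlt := hC₀ a b c habc ha hb
  obtain ⟨ha0, hb0, hsum, _⟩ := habc
  set X : ℝ := ((rad a b c : ℕ) : ℝ) ^ (1 + ε / 6) with hX
  have hR0 : (0 : ℝ) ≤ ((rad a b c : ℕ) : ℝ) := Nat.cast_nonneg _
  have hX0 : 0 ≤ X := Real.rpow_nonneg hR0 _
  have hc0 : (0 : ℝ) ≤ (c : ℝ) := Nat.cast_nonneg _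
  -- c ≤ |C₀| X
  have hcle : (c : ℝ) ≤ |C₀| * X := by
    have : C₀ * X ≤ |C₀| * X := mul_le_mul_of_nonneg_right (le_abs_self C₀) hX0
    linarith
  -- (abc)² ≤ c⁶
  have hale : a ≤ c := by omega
  have hble : b ≤ c := by omega
  have habc_le : ((a * b * c : ℕ) : ℝ) ≤ (c : ℝ) ^ 3 := by
    have : a * b * c ≤ c * c * c := by gcongr
    calc ((a * b * c : ℕ) : ℝ) ≤ ((c * c * c : ℕ) : ℝ) := by exact_mod_cast this
      _ = (c : ℝ) ^ 3 := by push_cast; ring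
  have h0abc : (0 : ℝ) ≤ ((a * b * c : ℕ) : ℝ) := Nat.cast_nonneg _
  have hsq : ((a * b * c : ℕ) : ℝ) ^ 2 ≤ ((c : ℝ) ^ 3) ^ 2 := pow_le_pow_left₀ h0abc habc_le 2
  have hpow6 : (c : ℝ) ^ 6 ≤ (|C₀| * X) ^ 6 := pow_le_pow_left₀ hc0 hcle 6
  have hX6 : X ^ 6 = ((rad a b c : ℕ) : ℝ) ^ (6 + ε) := by
    rw [hX, ← Real.rpow_natCast, ← Real.rpow_mul hR0]
    norm_num
    ring_nf
  calc ((a * b * c : ℕ) : ℝ) ^ 2 ≤ ((c : ℝ) ^ 3) ^ 2 := hsq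
    _ = (c : ℝ) ^ 6 := by ring
    _ ≤ (|C₀| * X) ^ 6 := hpow6
    _ = |C₀| ^ 6 * X ^ 6 := by ring
    _ = |C₀| ^ 6 * ((rad a b c : ℕ) : ℝ) ^ (6 + ε) := by rw [hX6]

/-- **The `∀ κ` in `H` is spurious**: the crux is equivalent to "abc on the single cell `min(a,b) ≥ c/4`
implies abc". (`→`: squaring descent `quarterWindowGivesCrux_proof` + currency change
`balancedABC_of_balancedFreySzpiro`, both landed in the tree; `←`: specialise `H` at `κ = 1/4`.) -/
theorem crux_iff_quarter : CompactBalanceTransfer ↔ (QuarterBalancedABC → _root_.ABC) := by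
  constructor
  · intro hT hQ
    apply hT
    have hX : BalancedFreySzpiro :=
      Summit.ABC.ABC.Theorems.quarterWindowGivesCrux_proof (szpiroQuarter_of_quarterBalancedABC hQ)
    exact Summit.ABC.ABC.Theorems.balancedABC_of_balancedFreySzpiro hX
  · intro h hH
    exact h (fun ε hε => hH (1 / 4) (by norm_num) ε hε)

/-- The weakest single-balance form of the crux (`κ = 1/4`), for provers who want the sharp target. -/
def CompactBalanceTransferQuarter : Prop := QuarterBalancedABC → _root_.ABC

theorem crux_iff_quarter' : CompactBalanceTransfer ↔ CompactBalanceTransferQuarter := crux_iff_quarter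

/-! ## §4 Line `Sketch`: the stub `CuspWeightedReceptacle` (verbatim restatement)

The line's module `Summits.ABC.ABC.Cruxes.CompactBalanceTransfer.Lines.Sketch` is not a built module on the
farm, so the stub is restated verbatim (same term) for the negative lemmas of later cycles. -/

/-- VERBATIM `LineSketch.CuspWeightedReceptacle` (card `cusp-weighted-receptacle`): cusp-weighted tame-local
`ℤ/ℓⁿ` receptacle with lower window `c₁ (v_p c − 1 − ε) log p ≤ t` and NO balance hypothesis. -/
def CuspWeightedReceptacle : Prop :=
  ∀ ε : ℝ, 0 < ε → ∃ c₁ c₁' c₃ : ℝ, 0 < c₁ ∧ ∃ m₀ : ℕ, ∀ ℓ n : ℕ, ℓ.Prime → 5 ≤ ℓ → m₀ ≤ ℓ ^ n →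
    ∃ t : ℕ → ℕ → ℕ → ℕ → ℕ → ℕ → ℕ → ℤ,
      (∀ p i j k r s z : ℕ, p.Prime →
        c₁ * (((k : ℕ) : ℝ) - 1 - ε) * Real.log p ≤ (t p i j k r s z : ℝ) ∧
        |(t p i j k r s z : ℝ)| ≤ c₁' * (((i + j + k : ℕ) : ℝ) + 1) * Real.log p) ∧
      ∀ a b c : ℕ, IsABCTriple a b c → ¬ ℓ ∣ a * b * c →
        ∃ B : ℤ, |(B : ℝ)| ≤ c₃ ∧
          (∑ p ∈ (a * b * c).primeFactors,
              t p (a.factorization p) (b.factorization p) (c.factorization p)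
                (a / p ^ a.factorization p % p) (b / p ^ b.factorization p % p)
                (c / p ^ c.factorization p % p)) ≡ B [ZMOD ((ℓ ^ n : ℕ) : ℤ)]

/-- RESIDUE-FREE strengthening of the stub (tables blind to the unit residues `r, s, z`). Refuted on paper by
the three triples `(1, 2^k−1, 2^k)`, `(2, 2^k−1, 2^k+1)`, `(1, 2^k, 2^k+1)`:
`S₁ − S₂ + S₃ = t(2;0,0,k) − t(2;1,0,0) + t(2;0,k,0) ≥ c₁(k − 2 − 2ε) log 2 − 2c₁' log 2` against `≤ 3c₃`.
(Lean proof = the lead's deliverable `CuspWeightedResidueFree.lean`; see PICKED.md.) -/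
def CuspWeightedResidueFree : Prop :=
  ∀ ε : ℝ, 0 < ε → ∃ c₁ c₁' c₃ : ℝ, 0 < c₁ ∧ ∃ m₀ : ℕ, ∀ ℓ n : ℕ, ℓ.Prime → 5 ≤ ℓ → m₀ ≤ ℓ ^ n →
    ∃ t : ℕ → ℕ → ℕ → ℕ → ℤ,
      (∀ p i j k : ℕ, p.Prime →
        c₁ * (((k : ℕ) : ℝ) - 1 - ε) * Real.log p ≤ (t p i j k : ℝ) ∧
        |(t p i j k : ℝ)| ≤ c₁' * (((i + j + k : ℕ) : ℝ) + 1) * Real.log p) ∧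
      ∀ a b c : ℕ, IsABCTriple a b c → ¬ ℓ ∣ a * b * c →
        ∃ B : ℤ, |(B : ℝ)| ≤ c₃ ∧
          (∑ p ∈ (a * b * c).primeFactors,
              t p (a.factorization p) (b.factorization p) (c.factorization p)) ≡ B [ZMOD ((ℓ ^ n : ℕ) : ℤ)]

/-- The residue-free form is the special case of the stub with `r, s, z` ignored. -/
theorem cuspWeighted_of_residueFree (h : CuspWeightedResidueFree) : CuspWeightedReceptacle := by
  intro ε hε
  obtain ⟨c₁, c₁', c₃, hc₁, m₀, H⟩ := h ε hε
  refine ⟨c₁, c₁', c₃, hc₁, m₀, fun ℓ n hℓ h5 hm => ?_⟩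
  obtain ⟨t, ht, hT⟩ := H ℓ n hℓ h5 hm
  exact ⟨fun p i j k _ _ _ => t p i j k, fun p i j k _ _ _ hp => ht p i j k hp, hT⟩


/-! ### §4.1 Block sharing with residues (the mechanism behind the polynomial families)

The lead's no-go ("two triples share a block `X` with all residues only if their small members are congruent
mod `rad X`, impossible for distinct members `< X`") misses members that differ by `X` itself: -/

/-- At every prime `p ∣ 2^k − 1` the triples `(2^k − 1, 1, 2^k)` and `(2^k − 1, 2^k, 2^{k+1} − 1)` present the SAME
local datum at `p`: same valuation of the a-member `2^k − 1`, same unit residue of it, and the same residues of the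
other two members, namely `b ≡ 1`, `c ≡ 1 (mod p)` in both (`2^k ≡ 1`, `2^{k+1} − 1 ≡ 1`). Hence a residue-dependent
table cannot separate their a-blocks. [folklore] -/
theorem shared_mersenne_block {k p : ℕ} (hk : 1 ≤ k) (hp : p ∣ 2 ^ k - 1) :
    2 ^ k % p = 1 % p ∧ (2 ^ (k + 1) - 1) % p = 1 % p := by
  have hpow : 1 ≤ 2 ^ k := Nat.one_le_two_pow
  obtain ⟨d, hd⟩ := hp
  have h1 : 2 ^ k = p * d + 1 := by omega
  have h2 : 2 ^ (k + 1) - 1 = p * (2 * d) + 1 := by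
    have e : p * (2 * d) = 2 * (p * d) := by ring
    rw [pow_succ, e]; omega
  constructor
  · rw [h1, Nat.mul_add_mod]
  · rw [h2, Nat.mul_add_mod]

/-- … and `(2^k − 1, 2^k, 2^{k+1} − 1)` is indeed an abc-triple (the `y ↦ (y−1, y, 2y−1)` identity at `y = 2^k`).
[folklore] -/
theorem isABCTriple_mersenne_shift {k : ℕ} (hk : 1 ≤ k) : IsABCTriple (2 ^ k - 1) (2 ^ k) (2 ^ (k + 1) - 1) := by
  have hpow : 2 ≤ 2 ^ k := by
    calc 2 = 2 ^ 1 := by norm_num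
      _ ≤ 2 ^ k := Nat.pow_le_pow_right (by norm_num) hk
  refine ⟨by omega, by positivity, by rw [pow_succ]; omega, ?_⟩
  -- gcd(2^k - 1, 2^k) = 1: consecutive integers
  have : 2 ^ k = (2 ^ k - 1) + 1 := by omega
  rw [this]
  exact Nat.coprime_self_add_right.mpr (Nat.coprime_one_right _)

end Summit.ABC.ABC.Cruxes.CompactBalanceTransfer.Disproof
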